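import Summits.QuantumFields.BalabanUV.Beta.GAN24.SlabSmoothingBound
import Summits.QuantumFields.BalabanUV.Beta.GAN24.PlantedWordDefectLaw

/-!
# `BalabanUV.Beta.GAN24.AlmostNestedWordRate` — binder row G-an2-4 ∕ (CONV-C), routes C-R6° («VALUES») × R7 («TWO CURRENCIES»), PART 228:
# CENSUS V204′ (ii) — THE INSERTION WORD OF AN ALMOST NESTED BOUNDED SINGLE-DIRECTION BACKGROUND CONVERGES ALONG BAŁABAN's TOWER AT RATIO `√(L⁻¹)` IN OPERATOR NORM, AND
# ITS LEGS HAVE THE TWO ENVELOPES (L-UD)+(L-SR) AT RATIO `L^{−1∕4}` — «almost nested» = the block average of `V^{(k+1)}` equals `V^{(k)}` OFF a union of coordinate slabs of at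
# most `m` fine layers per direction (PART 213's `ρ ≤ 0` balls: the far faces; every NESTED family: `m = 0`); NO Lipschitz letter, NO smoothness (unit b2b-balaban-gan24-p3, gen 64; v1)

NOT IN PRINT; OUR PROOF ([folklore] bookkeeping BY NAME over PART 227 (`towerLimitRate_plantedWordDefect`), PART 226 (`opNorm_calGlev_mul_slab_le` — the analysis), PART 219
(`Pmodel_single`), PART 218 (`plantedG_le_lev`, `plantedW_le_lev`, `pairingW_le_lev`), PART 198 (`exists_twoPoint_insertion`), NE2 ∕ T4 Support (`freeTowerLaws_balaban`, `JK_apply`,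
`opNorm_diagonal_le`, `calDalev_inv`, `decayRate_of_towerLimitRate`); [King1986] (2.10) p. 653 the block parent; [Balaban1984PropagatorsI] Prop. 1.1 (1.89) p. 33 the only printed
estimate; nothing printed is a hypothesis).
HONEST FRAMING (cell contract, verbatim): «discharging `BetaPertH` makes Bałaban's UV stability UNCONDITIONAL — a real constructive-QFT result; it is NOT the
continuum limit and NOT the Clay problem.»  HONEST DEPENDENCY (verbatim): «continuum YM on T⁴ ⇐ BetaPertH ∧ nine spine estimates (0/9 proved); BetaPertH ⇐
(D1) ∧ (D4) ∧ CAP+tail; G-an2-4 gates asym, D1 and NE2/3/4.»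

WHAT THIS FILE PROVES (0 sorry, 0 `def`; `n_k = lev L k`, `J = JK n_k L` King's pairing, `𝒢_k = calGlev k`, `P_k = Pmodel V k`; EVERY torus `M`):
* §1 **`JK_conjTranspose_mul_diagonal_mul_JK`** — `Jᴴ·diag(V′)·J = diag(block average of V′)`: `(R^d)⁻¹·Σ_{parT x = y} V′(x)` on the diagonal (so the nesting defect of PART 227
  is the diagonal of `blockavg(V^{(k+1)}) − V^{(k)}`).
* §2 **`opNorm_mul_diagonal_le_of_slabs`** — SUPPORT-SENSITIVE SMALLNESS: if `‖G·𝟙_{A_ν}‖ ≤ s` for every direction `ν` and `e` is supported in `⋃_ν {w : w₁(ν) ∈ A_ν}`, then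
  `‖G·diag(e)‖ ≤ d·s·‖diag(e)‖` (partition of the support with the counting weights `[w₁(ν) ∈ A_ν]∕#{μ : w₁(μ) ∈ A_μ}`).
* §3 **`towerLimitRate_almostNestedWord`** — `‖V^{(k)}‖ ≤ α`, one direction `μ₀`, and `blockavg(V^{(k+1)}_{μ₀})(u) = V^{(k)}_{μ₀}(u)` whenever `u₁(ν) ∉ A_{k,ν}` for all `ν`
  (`#A_{k,ν} ≤ m`) ⟹ `TowerLimitRate (QBlev) (L^d) (k ↦ 𝒢_kP_k𝒢_k) C(d,L,a,α,m) √(L⁻¹)`.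
* §4 **`exists_twoPoint_insertion_rate_almostNested`** — `∃ κ > 0, B, B′ ≥ 0` from `(d, L, a, α, c₀, m)` only: (L-UD) `B·e^{−κ(distK(x,i)+distK(y,i))}` and (L-SR)
  `B′·(L^{−1∕4})^k·e^{−κ(…)}` for the insertion word of every such family supported where `ρ_{k,i} ≤ c₀`, on EVERY torus.
WHAT IT DOES NOT DO: two insertions (PART 229+); the defect geometry of a given profile (the `ρ ≤ 0` balls: later); the ENDs (next).  SUPPLIER work; NEVER «G-an2-4 closed»;
NOT (CONV-C), NOT D1, NOT `BetaPertH`, NOT continuum, NOT Clay.  Records: `HOME/b2b-balaban-gan24-p3/gen64/README.md`.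
-/

noncomputable section

open scoped BigOperators ComplexConjugate Matrix Matrix.Norms.L2Operator
open Filter Topology Finset

namespace Summit.QuantumFields.BalabanUV.Beta.GAN24.AlmostNestedWordRate

open Literature.MathematicalPhysics.QuantumFieldTheory.Balaban1983to89
open Literature.MathematicalPhysics.QuantumFieldTheory.Balaban1983to89.B5Prop11Plancherel (Tor fine Cst Cst_nonneg fdiff calG opNorm_calG_le opNorm_fdiff_calG_le)
open Literature.MathematicalPhysics.QuantumFieldTheory.Balaban1983to89.B5G183RateTorusW (CQL)
open Literature.MathematicalPhysics.QuantumFieldTheory.Balaban1983to89.B5G183RateUnitTower (lev)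
open Summit.QuantumFields.BalabanUV.T4Continuum
open Summit.QuantumFields.BalabanUV.T4Continuum.CovariantAveragingTower (avgTow TowerLimitRate)
open Summit.QuantumFields.BalabanUV.T4Continuum.BalabanAveragedTowerUnit (idx QBlev calGlev one_le_lev')
open Summit.QuantumFields.BalabanUV.T4Continuum.BalabanAveragingPairing (FQBlev freeTowerLaws_balaban)
open Summit.QuantumFields.BalabanUV.T4Continuum.KingPairingPlantedLaw (JK JpcT calDalev calDalev_inv CJ CJ_nonneg)
open Summit.QuantumFields.BalabanUV.T4Continuum.BlockPairingGeometry (parT JK_apply opNorm_diagonal_le)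
open Summit.QuantumFields.BalabanUV.T4Continuum.FirstOrderBackgroundModel (Pmodel)
open Summit.QuantumFields.BalabanUV.T4Continuum.CTKingTowerWeights (rho distK)
open Summit.QuantumFields.BalabanUV.T4Continuum.DecayRateInterpolation (EntryDecay TwoLevelDecayRate decayRate_of_towerLimitRate)
open Summit.QuantumFields.BalabanUV.Beta.GAN24.UnitLatticeDecayAlgebra (distK_nonneg)
open Summit.QuantumFields.BalabanUV.Beta.GAN24.InsertionWordTwoPointDecay (exists_twoPoint_insertion)
open Summit.QuantumFields.BalabanUV.Beta.GAN24.DerivativeItemPlantedLaw (plantedG_le_lev plantedW_le_lev pairingW_le_lev)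
open Summit.QuantumFields.BalabanUV.Beta.GAN24.NestedBackgroundWordRate (Pmodel_single)
open Summit.QuantumFields.BalabanUV.Beta.GAN24.SlabSmoothingBound (opNorm_calGlev_mul_slab_le)
open Summit.QuantumFields.BalabanUV.Beta.GAN24.PlantedWordDefectLaw (towerLimitRate_plantedWordDefect)

variable {d : ℕ} (L : ℕ) [NeZero L] (M : Fin d → ℕ) [hM : ∀ μ, NeZero (M μ)] (a : ℝ) (ha : 0 < a)

/-! ## §1 Block averages through King's pairing -/

omit [NeZero L] in
/-- **`JK_conjTranspose_mul_diagonal_mul_JK`** — `J_Rᴴ·diag(V′)·J_R = diag(blockavg V′)`, `blockavg V′(y) = R^{−d}·Σ_{parT x = y} V′(x)`: reading a fine multiplier through King's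
pairing is averaging it over the `R`-blocks (entries of `J_R` = `R^{−d∕2}·[parT x = y]`, `JK_apply`). [cite: King1986, (2.10) p.653 (block parent)] [folklore] -/
theorem JK_conjTranspose_mul_diagonal_mul_JK (N R : ℕ) [NeZero N] [NeZero R] (V' : Tor (fine (R * N) M) × Fin d → ℂ) :
    (JK N R M)ᴴ * Matrix.diagonal V' * JK N R M
      = Matrix.diagonal (fun y => ((R : ℂ) ^ d)⁻¹ * ∑ x ∈ univ.filter (fun x => parT N R M x = y), V' x) := by
  have hR0 : (0 : ℝ) ≤ (R : ℝ) ^ d := pow_nonneg (Nat.cast_nonneg _) d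
  have hRne : ((R : ℝ) ^ d) ≠ 0 := pow_ne_zero _ (by exact_mod_cast NeZero.ne R)
  have hc : ∀ (x : Tor (fine (R * N) M) × Fin d) (z : Tor (fine N M) × Fin d),
      JK N R M x z = if parT N R M x = z then (((Real.sqrt ((R : ℝ) ^ d) / (R : ℝ) ^ d : ℝ)) : ℂ) else 0 := by
    intro x z
    rw [JK_apply]
    split_ifs
    · push_cast; ring
    · simp
  have hcc : ((((Real.sqrt ((R : ℝ) ^ d) / (R : ℝ) ^ d : ℝ)) : ℂ)) * (((Real.sqrt ((R : ℝ) ^ d) / (R : ℝ) ^ d : ℝ)) : ℂ) = ((R : ℂ) ^ d)⁻¹ := by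
    rw [← Complex.ofReal_mul, div_mul_div_comm, Real.mul_self_sqrt hR0, div_mul_eq_div_div, div_self hRne, one_div]
    push_cast; rfl
  ext y y'
  rw [Matrix.mul_assoc, Matrix.mul_apply]
  simp only [Matrix.conjTranspose_apply, Matrix.diagonal_mul, hc]
  by_cases hy : y = y'
  · subst hy
    rw [Matrix.diagonal_apply_eq, mul_sum, sum_filter]
    refine (sum_congr rfl fun x _ => ?_)
    by_cases h1 : parT N R M x = y
    · rw [if_pos h1, if_pos h1, Complex.star_def, Complex.conj_ofReal, ← hcc]
      ring
    · rw [if_neg h1, if_neg h1]; simp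
  · rw [Matrix.diagonal_apply_ne _ hy]
    refine sum_eq_zero fun x _ => ?_
    by_cases h1 : parT N R M x = y
    · rw [if_pos h1, if_neg (fun h2 => hy (h1.symm.trans h2))]; simp
    · rw [if_neg h1]; simp

/-! ## §2 Support-sensitive smallness: a multiplier supported on a union of slabs -/

omit [NeZero L] in
/-- **`opNorm_mul_diagonal_le_of_slabs` — SUPPORT-SENSITIVE SMALLNESS** [our proof]: if `‖G·𝟙_{A_ν}‖ ≤ s` for every direction `ν` (`𝟙_{A_ν} = diag[w₁(ν) ∈ A_ν]`) and the multiplier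
`e` is supported in `⋃_ν {w : w₁(ν) ∈ A_ν}`, then `‖G·diag(e)‖ ≤ d·s·‖diag(e)‖` — `diag(e) = Σ_ν 𝟙_{A_ν}·diag(ω_ν)·diag(e)` with the counting weights `ω_ν(w) =
[w₁(ν) ∈ A_ν]∕#{μ : w₁(μ) ∈ A_μ} ∈ [0,1]`. -/
theorem opNorm_mul_diagonal_le_of_slabs {n : ℕ} [NeZero n] (G : Matrix (Tor (fine n M) × Fin d) (Tor (fine n M) × Fin d) ℂ)
    (A : (ν : Fin d) → Finset (ZMod (fine n M ν))) {s : ℝ} (hs : 0 ≤ s)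
    (hG : ∀ ν, ‖G * Matrix.diagonal (fun w : Tor (fine n M) × Fin d => if w.1 ν ∈ A ν then (1 : ℂ) else 0)‖ ≤ s)
    (e : Tor (fine n M) × Fin d → ℂ) (he : ∀ w, e w ≠ 0 → ∃ ν, w.1 ν ∈ A ν) :
    ‖G * Matrix.diagonal e‖ ≤ d * s * ‖Matrix.diagonal e‖ := by
  -- the counting weights
  set c : Tor (fine n M) × Fin d → ℕ := fun w => (univ.filter (fun ν : Fin d => w.1 ν ∈ A ν)).card with hc
  set ω : Fin d → Tor (fine n M) × Fin d → ℂ := fun ν w => if w.1 ν ∈ A ν then ((c w : ℂ))⁻¹ else 0 with hω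
  have hω1 : ∀ ν w, ‖ω ν w‖ ≤ 1 := by
    intro ν w
    simp only [hω]
    split_ifs with h
    · have h1 : 1 ≤ c w := card_pos.mpr ⟨ν, mem_filter.mpr ⟨mem_univ ν, h⟩⟩
      rw [norm_inv, Complex.norm_natCast]
      exact inv_le_one_of_one_le₀ (by exact_mod_cast h1)
    · simp
  have hsum : ∀ w, (∃ ν, w.1 ν ∈ A ν) → ∑ ν, (if w.1 ν ∈ A ν then (1 : ℂ) else 0) * ω ν w = 1 := by
    intro w hw
    have h1 : 1 ≤ c w := by obtain ⟨ν, h⟩ := hw; exact card_pos.mpr ⟨ν, mem_filter.mpr ⟨mem_univ ν, h⟩⟩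
    have hc0 : (c w : ℂ) ≠ 0 := by exact_mod_cast (by omega : c w ≠ 0)
    have e1 : ∀ ν, (if w.1 ν ∈ A ν then (1 : ℂ) else 0) * ω ν w = if w.1 ν ∈ A ν then ((c w : ℂ))⁻¹ else 0 := by
      intro ν; simp only [hω]; split_ifs <;> simp
    simp_rw [e1]
    rw [← sum_filter, sum_const, nsmul_eq_mul, hc, mul_inv_cancel₀ hc0]
  -- the partition of `diag(e)`
  have key : Matrix.diagonal e = ∑ ν, Matrix.diagonal (fun w : Tor (fine n M) × Fin d => if w.1 ν ∈ A ν then (1 : ℂ) else 0) * (Matrix.diagonal (ω ν) * Matrix.diagonal e) := by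
    ext i j
    rw [Matrix.sum_apply]
    simp only [Matrix.diagonal_mul_diagonal, Matrix.diagonal_apply]
    by_cases hij : i = j
    · subst hij
      simp only [if_true]
      by_cases hei : e i = 0
      · simp [hei]
      · have h2 : ∑ x, (if i.1 x ∈ A x then (1 : ℂ) else 0) * (ω x i * e i) = (∑ x, (if i.1 x ∈ A x then (1 : ℂ) else 0) * ω x i) * e i := by
          rw [sum_mul]; exact sum_congr rfl fun x _ => by ring
        rw [h2, hsum i (he i hei), one_mul]
    · simp [hij]
  have hωe : ∀ ν, ‖Matrix.diagonal (ω ν) * Matrix.diagonal e‖ ≤ ‖Matrix.diagonal e‖ := fun ν =>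
    calc ‖Matrix.diagonal (ω ν) * Matrix.diagonal e‖ ≤ ‖Matrix.diagonal (ω ν)‖ * ‖Matrix.diagonal e‖ := Matrix.l2_opNorm_mul _ _
      _ ≤ 1 * ‖Matrix.diagonal e‖ := mul_le_mul_of_nonneg_right (opNorm_diagonal_le (fine n M) zero_le_one (hω1 ν)) (norm_nonneg _)
      _ = ‖Matrix.diagonal e‖ := one_mul _
  calc ‖G * Matrix.diagonal e‖
      = ‖∑ ν, G * (Matrix.diagonal (fun w : Tor (fine n M) × Fin d => if w.1 ν ∈ A ν then (1 : ℂ) else 0) * (Matrix.diagonal (ω ν) * Matrix.diagonal e))‖ := by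
        conv_lhs => rw [key, mul_sum]
    _ ≤ ∑ ν, ‖G * (Matrix.diagonal (fun w : Tor (fine n M) × Fin d => if w.1 ν ∈ A ν then (1 : ℂ) else 0) * (Matrix.diagonal (ω ν) * Matrix.diagonal e))‖ := norm_sum_le _ _
    _ ≤ ∑ _ν : Fin d, s * ‖Matrix.diagonal e‖ := sum_le_sum fun ν _ => by
        rw [← Matrix.mul_assoc]
        exact (Matrix.l2_opNorm_mul _ _).trans (mul_le_mul (hG ν) (hωe ν) (norm_nonneg _) hs)
    _ = d * s * ‖Matrix.diagonal e‖ := by rw [sum_const, card_univ, Fintype.card_fin, nsmul_eq_mul]; ring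

/-! ## §3 The tower rate of the word for almost nested bounded single-direction backgrounds -/

/-- **`towerLimitRate_almostNestedWord` — THE INSERTION WORD OF AN ALMOST NESTED BOUNDED BACKGROUND CONVERGES ALONG BAŁABAN's TOWER AT RATIO `√(L⁻¹)` IN OPERATOR NORM**
[our proof] (`L ≥ 2`; `‖V^{(k)}_μ(u)‖ ≤ α`, `V^{(k)}_μ = 0` for `μ ≠ μ₀`; the block average of `V^{(k+1)}_{μ₀}` over the children of `u` equals `V^{(k)}_{μ₀}(u)` unless `u₁(ν) ∈ A_{k,ν}`
for some `ν`, `#A_{k,ν} ≤ m`; EVERY torus): `TowerLimitRate (QBlev L M) (L^d) (k ↦ 𝒢_kP_k𝒢_k) C √(L⁻¹)` with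
`C = αCst·CJ + Cst·α·(CQL + 4dCst) + Cst·(d·(Cst√(3m))·(2α)) + αCst·dLCst + Cst·α·dLCst` — PART 227's defect law on `freeTowerLaws_balaban` with PART 218's planted letters
(rate `L⁻¹ ≤ √(L⁻¹)`) and the DEFECT letter `‖𝒢_k·diag(blockavg V^{(k+1)} − V^{(k)})‖ ≤ d·Cst√(3m)(√(L⁻¹))^k·2α` (§1, §2, PART 226). -/
theorem towerLimitRate_almostNestedWord (hL : 2 ≤ L) {α : ℝ} (hα : 0 ≤ α) {m : ℕ} {V : (k : ℕ) → Fin d → (idx L M k → ℂ)} {μ₀ : Fin d}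
    (hVb : ∀ k μ u, ‖V k μ u‖ ≤ α) (hdir : ∀ k μ u, μ ≠ μ₀ → V k μ u = 0)
    (A : (k : ℕ) → (ν : Fin d) → Finset (ZMod (fine (lev L k) M ν))) (hA : ∀ k ν, (A k ν).card ≤ m)
    (hdef : ∀ k (u : idx L M k), (∀ ν, u.1 ν ∉ A k ν) →
      ((L : ℂ) ^ d)⁻¹ * ∑ x ∈ univ.filter (fun x : idx L M (k + 1) => parT (lev L k) L M x = u), V (k + 1) μ₀ x = V k μ₀ u) :
    TowerLimitRate (QBlev L M) ((L : ℝ) ^ d) (fun k => calGlev L M a ha k * Pmodel L M V k * calGlev L M a ha k)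
      (α * Cst d a * CJ d a + Cst d a * α * (CQL d a + 4 * d * Cst d a) + Cst d a * (d * (Cst d a * Real.sqrt (3 * m)) * (2 * α))
        + α * Cst d a * (d * L * Cst d a) + Cst d a * α * (d * L * Cst d a)) (Real.sqrt ((L : ℝ)⁻¹)) := by
  have hL1 : (1 : ℝ) < L := by exact_mod_cast (lt_of_lt_of_le one_lt_two hL : 1 < L)
  have hr : (0 : ℝ) < (L : ℝ) ^ d := pow_pos (lt_trans zero_lt_one hL1) d
  have hρ0 : (0 : ℝ) ≤ (L : ℝ)⁻¹ := inv_nonneg.mpr (Nat.cast_nonneg _)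
  have hρ1 : ((L : ℝ)⁻¹) < 1 := inv_lt_one_of_one_lt₀ hL1
  have hσ1 : Real.sqrt ((L : ℝ)⁻¹) < 1 := by
    rw [show (1 : ℝ) = Real.sqrt 1 from Real.sqrt_one.symm]
    exact Real.sqrt_lt_sqrt hρ0 hρ1
  have hρσ : (L : ℝ)⁻¹ ≤ Real.sqrt ((L : ℝ)⁻¹) := by
    calc (L : ℝ)⁻¹ = Real.sqrt (((L : ℝ)⁻¹) ^ 2) := (Real.sqrt_sq hρ0).symm
      _ ≤ Real.sqrt ((L : ℝ)⁻¹) := Real.sqrt_le_sqrt (by nlinarith)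
  have hpow : ∀ k, ((L : ℝ)⁻¹) ^ k ≤ Real.sqrt ((L : ℝ)⁻¹) ^ k := fun k => pow_le_pow_left₀ hρ0 hρσ k
  have hCst := Cst_nonneg d a
  have hfree := freeTowerLaws_balaban L M a ha
  -- the defect letter
  have hq : ∀ k, ‖(calDalev L M a ha k)⁻¹ * ((JpcT L M k)ᴴ * Matrix.diagonal (V (k + 1) μ₀) * JpcT L M k - Matrix.diagonal (V k μ₀))‖
      ≤ (d * (Cst d a * Real.sqrt (3 * m)) * (2 * α)) * Real.sqrt ((L : ℝ)⁻¹) ^ k := by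
    intro k
    have hE : (JpcT L M k)ᴴ * Matrix.diagonal (V (k + 1) μ₀) * JpcT L M k - Matrix.diagonal (V k μ₀)
        = Matrix.diagonal (fun u : idx L M k => ((L : ℂ) ^ d)⁻¹ * ∑ x ∈ univ.filter (fun x : idx L M (k + 1) => parT (lev L k) L M x = u), V (k + 1) μ₀ x - V k μ₀ u) := by
      have h1 : (JpcT L M k)ᴴ * Matrix.diagonal (V (k + 1) μ₀) * JpcT L M k
          = Matrix.diagonal (fun u : idx L M k => ((L : ℂ) ^ d)⁻¹ * ∑ x ∈ univ.filter (fun x : idx L M (k + 1) => parT (lev L k) L M x = u), V (k + 1) μ₀ x) :=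
        JK_conjTranspose_mul_diagonal_mul_JK M (lev L k) L (V (k + 1) μ₀)
      rw [h1, Matrix.diagonal_sub]
    have hEn : ‖(JpcT L M k)ᴴ * Matrix.diagonal (V (k + 1) μ₀) * JpcT L M k - Matrix.diagonal (V k μ₀)‖ ≤ 2 * α := by
      refine (norm_sub_le _ _).trans ?_
      have h1 : ‖(JpcT L M k)ᴴ * Matrix.diagonal (V (k + 1) μ₀) * JpcT L M k‖ ≤ α := by
        have hJ := hfree.opNorm_J_le k
        have hJ' : ‖(JpcT L M k)ᴴ‖ ≤ 1 := by rw [Matrix.l2_opNorm_conjTranspose]; exact hJ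
        calc _ ≤ ‖(JpcT L M k)ᴴ * Matrix.diagonal (V (k + 1) μ₀)‖ * ‖JpcT L M k‖ := Matrix.l2_opNorm_mul _ _
          _ ≤ (‖(JpcT L M k)ᴴ‖ * ‖Matrix.diagonal (V (k + 1) μ₀)‖) * 1 := mul_le_mul (Matrix.l2_opNorm_mul _ _) hJ (norm_nonneg _) (mul_nonneg (norm_nonneg _) (norm_nonneg _))
          _ ≤ (1 * α) * 1 := mul_le_mul_of_nonneg_right (mul_le_mul hJ' (opNorm_diagonal_le (fine (lev L (k + 1)) M) hα fun u => hVb (k + 1) μ₀ u) (norm_nonneg _) zero_le_one) zero_le_one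
          _ = α := by ring
      have h2 : ‖Matrix.diagonal (V k μ₀)‖ ≤ α := opNorm_diagonal_le (fine (lev L k) M) hα fun u => hVb k μ₀ u
      linarith
    have hs : ∀ ν, ‖calGlev L M a ha k * Matrix.diagonal (fun w : idx L M k => if w.1 ν ∈ A k ν then (1 : ℂ) else 0)‖ ≤ Cst d a * Real.sqrt (3 * m) * Real.sqrt ((L : ℝ)⁻¹) ^ k := by
      intro ν
      refine (opNorm_calGlev_mul_slab_le L M a ha k ν (A k ν)).trans (mul_le_mul_of_nonneg_right (mul_le_mul_of_nonneg_left (Real.sqrt_le_sqrt ?_) hCst) (pow_nonneg (Real.sqrt_nonneg _) k))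
      exact_mod_cast Nat.mul_le_mul_left 3 (hA k ν)
    have he : ∀ w : idx L M k, (((L : ℂ) ^ d)⁻¹ * ∑ x ∈ univ.filter (fun x : idx L M (k + 1) => parT (lev L k) L M x = w), V (k + 1) μ₀ x - V k μ₀ w) ≠ 0 → ∃ ν, w.1 ν ∈ A k ν := by
      intro w hw
      by_contra hne
      exact hw (sub_eq_zero.mpr (hdef k w fun ν hν => hne ⟨ν, hν⟩))
    rw [calDalev_inv, hE]
    refine (opNorm_mul_diagonal_le_of_slabs M (calGlev L M a ha k) (A k) (by positivity) hs _ he).trans ?_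
    rw [← hE]
    calc (d : ℝ) * (Cst d a * Real.sqrt (3 * m) * Real.sqrt ((L : ℝ)⁻¹) ^ k) * ‖(JpcT L M k)ᴴ * Matrix.diagonal (V (k + 1) μ₀) * JpcT L M k - Matrix.diagonal (V k μ₀)‖
        ≤ (d : ℝ) * (Cst d a * Real.sqrt (3 * m) * Real.sqrt ((L : ℝ)⁻¹) ^ k) * (2 * α) := mul_le_mul_of_nonneg_left hEn (by positivity)
      _ = _ := by ring
  have hT := towerLimitRate_plantedWordDefect (Δ := calDalev L M a ha) (Dm := fun k => Matrix.diagonal (V k μ₀))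
    (W := fun k => fdiff (fine (lev L k) M) ((lev L k : ℕ) : ℂ) μ₀ * (calDalev L M a ha k)⁻¹) hr hfree
    (fun k => by rw [calDalev_inv]; exact opNorm_calG_le (lev L k) (one_le_lev' L k) M a ha)
    (fun k => opNorm_diagonal_le (fine (lev L k) M) hα fun u => hVb k μ₀ u)
    (fun k => by rw [calDalev_inv]; exact opNorm_fdiff_calG_le (lev L k) (one_le_lev' L k) M a ha μ₀)
    (fun k => by rw [calDalev_inv, calDalev_inv]; exact plantedG_le_lev L M a ha k)
    (fun k => by rw [calDalev_inv, calDalev_inv]; exact plantedW_le_lev L M a ha k μ₀)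
    hq
    (fun k => by rw [calDalev_inv]; exact pairingW_le_lev L M a ha k μ₀)
    hσ1 (fun k => mul_le_mul_of_nonneg_left (hpow k) (CJ_nonneg d a))
    (fun k => mul_le_mul_of_nonneg_left (hpow k) ((norm_nonneg _).trans ((plantedW_le_lev L (fun _ : Fin d => 1) a ha 0 μ₀).trans (by rw [pow_zero, mul_one]))))
    (fun k => le_rfl)
    (fun k => mul_le_mul_of_nonneg_left (hpow k) (by positivity))
    (fun k => mul_le_mul_of_nonneg_left (hpow k) (by positivity))
  have e : (fun k => (calDalev L M a ha k)⁻¹ * Matrix.diagonal (V k μ₀) * (fdiff (fine (lev L k) M) ((lev L k : ℕ) : ℂ) μ₀ * (calDalev L M a ha k)⁻¹))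
      = fun k => calGlev L M a ha k * Pmodel L M V k * calGlev L M a ha k := by
    funext k; rw [calDalev_inv, Pmodel_single L M hdir k]; simp only [Matrix.mul_assoc]
  rw [e] at hT
  exact hT

/-! ## §4 (L-UD)+(L-SR) for almost nested bounded single-direction families, volume-free -/

/-- **`exists_twoPoint_insertion_rate_almostNested` — THE TWO LEG ENVELOPES OF THE SINGLE-INSERTION WORD OF AN ALMOST NESTED BOUNDED LOCALISED SINGLE-DIRECTION BACKGROUND,
VOLUME-FREE** [our proof] (`L ≥ 2`, `α ≥ 0`, `c₀` arbitrary, `m` layers, direction `μ₀`): `∃ κ > 0, B, B′ ≥ 0` from `(d, L, a, α, c₀, m)` only such that for EVERY torus, EVERY unit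
bond `i`, EVERY family as in §3 supported where `ρ_{k,i} ≤ c₀`, and all `k, x, y`: `‖X_{i,k}(x,y)‖ ≤ B·e^{−κ(distK(x,i)+distK(y,i))}` and
`‖(X_{i,k+1} − X_{i,k})(x,y)‖ ≤ B′·(√(√(L⁻¹)))^k·e^{−κ(…)}` — PART 198 §3's (L-UD) interpolated with §3 by `decayRate_of_towerLimitRate`. -/
theorem exists_twoPoint_insertion_rate_almostNested (hL : 2 ≤ L) (α c₀ : ℝ) (hα : 0 ≤ α) (m : ℕ) (μ₀ : Fin d) :
    ∃ κ B B' : ℝ, 0 < κ ∧ 0 ≤ B ∧ 0 ≤ B' ∧ ∀ (M : Fin d → ℕ) [∀ μ, NeZero (M μ)] (i : idx L M 0) (V : (k : ℕ) → Fin d → (idx L M k → ℂ))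
      (A : (k : ℕ) → (ν : Fin d) → Finset (ZMod (fine (lev L k) M ν))),
      (∀ k μ u, ‖V k μ u‖ ≤ α) → (∀ k μ u, μ ≠ μ₀ → V k μ u = 0) → (∀ k ν, (A k ν).card ≤ m) →
      (∀ k (u : idx L M k), (∀ ν, u.1 ν ∉ A k ν) →
        ((L : ℂ) ^ d)⁻¹ * ∑ x ∈ univ.filter (fun x : idx L M (k + 1) => parT (lev L k) L M x = u), V (k + 1) μ₀ x = V k μ₀ u) →
      (∀ k μ u, V k μ u ≠ 0 → rho L M k i u ≤ c₀) →
      (∀ k x y, ‖avgTow (QBlev L M) ((L : ℝ) ^ d) (fun k => calGlev L M a ha k * Pmodel L M V k * calGlev L M a ha k) k x y‖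
        ≤ B * Real.exp (-(κ * (distK L M x i + distK L M y i)))) ∧
      (∀ k x y, ‖(avgTow (QBlev L M) ((L : ℝ) ^ d) (fun k => calGlev L M a ha k * Pmodel L M V k * calGlev L M a ha k) (k + 1)
          - avgTow (QBlev L M) ((L : ℝ) ^ d) (fun k => calGlev L M a ha k * Pmodel L M V k * calGlev L M a ha k) k) x y‖
        ≤ B' * Real.sqrt (Real.sqrt ((L : ℝ)⁻¹)) ^ k * Real.exp (-(κ * (distK L M x i + distK L M y i)))) := by
  obtain ⟨κ, B, hκ0, hB, hUD⟩ := exists_twoPoint_insertion L a ha α c₀ hα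
  set C : ℝ := α * Cst d a * CJ d a + Cst d a * α * (CQL d a + 4 * d * Cst d a) + Cst d a * (d * (Cst d a * Real.sqrt (3 * m)) * (2 * α))
        + α * Cst d a * (d * L * Cst d a) + Cst d a * α * (d * L * Cst d a) with hCdef
  have hL1 : (1 : ℝ) < L := by exact_mod_cast (lt_of_lt_of_le one_lt_two hL : 1 < L)
  have hρ0 : (0 : ℝ) ≤ (L : ℝ)⁻¹ := inv_nonneg.mpr (Nat.cast_nonneg _)
  have hρ1 : ((L : ℝ)⁻¹) < 1 := inv_lt_one_of_one_lt₀ hL1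
  have hσ0 : 0 ≤ Real.sqrt ((L : ℝ)⁻¹) := Real.sqrt_nonneg _
  have hσ1 : Real.sqrt ((L : ℝ)⁻¹) < 1 := by
    rw [show (1 : ℝ) = Real.sqrt 1 from Real.sqrt_one.symm]
    exact Real.sqrt_lt_sqrt hρ0 hρ1
  have hCst := Cst_nonneg d a
  have hCJ := CJ_nonneg d a
  have hCQL : 0 ≤ CQL d a + 4 * d * Cst d a := by
    have h := plantedW_le_lev L (fun _ : Fin d => 1) a ha 0 μ₀
    rw [pow_zero, mul_one] at h
    exact (norm_nonneg _).trans h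
  have hC0 : 0 ≤ C := by positivity
  refine ⟨κ / 2, B, Real.sqrt (2 * B * (2 * C / (1 - Real.sqrt ((L : ℝ)⁻¹)))), half_pos hκ0, hB, Real.sqrt_nonneg _,
    fun M _ i V A hVb hdir hA hdef hloc => ?_⟩
  have hT := towerLimitRate_almostNestedWord L M a ha hL hα hVb hdir A hA hdef
  have hdec : ∀ k, EntryDecay (fun x y => distK L M x i + distK L M y i)
      (avgTow (QBlev L M) ((L : ℝ) ^ d) (fun k => calGlev L M a ha k * Pmodel L M V k * calGlev L M a ha k) k) B κ :=
    fun k x y => hUD M i V hVb hloc k x y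
  obtain ⟨clim, -, -, -, hstep⟩ := decayRate_of_towerLimitRate hσ0 hσ1 hC0 hT hdec
  refine ⟨fun k x y => (hUD M i V hVb hloc k x y).trans (mul_le_mul_of_nonneg_left (Real.exp_le_exp.mpr ?_) hB), fun k x y => hstep k x y⟩
  have h0 : 0 ≤ distK L M x i + distK L M y i := add_nonneg (distK_nonneg L M _ _) (distK_nonneg L M _ _)
  nlinarith

end Summit.QuantumFields.BalabanUV.Beta.GAN24.AlmostNestedWordRate

end
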